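import Summits.BirchSwinnertonDyer.BirchSwinnertonDyer.Theorems.UniversalToricDescentDefectTransportAlgebraicHalf
import HarnessLib

/-!
# Route UniversalToricDescent — the algebraic half of act D's ♭T `DefectTransportModThree`, direction
# `E → E′`, in the additive λ-currency: `n + Σ_{v∈Σ} 3^{c_v}·s_v(E) = λ_alg(E′) + Σ_{v∈Σ} 3^{c_v}·s_v(E′)`

Lead prover bsd-wall-utd-p1 g11 (`--supports`; sequel of `UniversalToricDescentDefectTransportAlgebraicHalf`,
whose `defectTransport_algebraicHalf_local` gives the product form). Source = the WILD curve `E`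
(`X_{∅,0}(E/K_∞)` torsion with a generator of norm profile `n`), target = the mod-`3` twin `E′`:

* **`defectTransport_algebraicHalf_lambda`** — with (iv) `E(ℚ₃)[3] = 0`, Poitou–Tate ×2 and base finiteness
  at `v ∣ 3` for `E` and `E′`: the finite bad set `Σ = {v ∤ 3 : E_K or E′_K bad}`, exact indices `c_v`
  (`3^{c_v}` places of `K_∞` above `v`) and local exponents `#H¹(kerD κ v, E[3^∞])[3] = 3^{s_v}`,
  `#H¹(kerD κ v, E′[3^∞])[3] = 3^{s′_v}`, with `X_{∅,0}(E′)` torsion, a generator of profile `λ_alg(E′)`, and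
  `n + Σ_{v∈Σ} 3^{c_v} s_v = λ_alg(E′) + Σ_{v∈Σ} 3^{c_v} s′_v`;
* `defectTransport_algebraicHalf_lambda_of_rankOne` — `E`'s base finiteness discharged from rank-one data
  (`rank E(K) = 1`, `Ш(E/K)` finite, a point of infinite order); the TWIN's base finiteness stays an input.

The local exponents are Greenberg–Vatsal's `d_v` in closed form (`…LocalTermClosedForm`) and the local
groups are `p`-divisible (`…LocalH1DivisibleCurve`), so each Σ-term is `corank H¹(K_{∞,w}, ·[3^∞])`; the
ANALYTIC half of ♭T must produce `m + Σ_v 3^{c_v} d_v(E) = m′ + Σ_v 3^{c_v} d_v(E′)` for the frames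
(`Σ`-depleted congruence, unprinted at `27 ∣ N`), whence `n + m′ = n′ + m`.
THEOREMS ONLY; no definition, no named fact, no `sorry`. BSD is not advanced by this file.
References: [GreenbergVatsal2000] Thm. (1.4), §2 Prop. (2.4), (2.10) (pp. 23–28); [Brink2007] Thm. 2, Cor. 1;
[JetchevSkinnerWan2017] Prop. 3.2.1, Lemma 3.3.3.
-/

set_option autoImplicit false
-- `…BirchSwinnertonDyer.BirchSwinnertonDyer.Theorems…` is the problem's mandated namespace (D-0017).
set_option linter.dupNamespace false

noncomputable section

open scoped Classical

namespace Summit.BirchSwinnertonDyer.BirchSwinnertonDyer.Theorems.UniversalToricDescentDefectTransport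

open Function Field NumberField IsDedekindDomain WeierstrassCurve
open Literature.NumberTheory.GaloisRepresentations Literature.NumberTheory.EllipticCurves
  Literature.NumberTheory.EllipticCurves.GreenbergSelmer Literature.NumberTheory.GaloisCohomology
  Literature.NumberTheory.EllipticCurves.IwasawaAlgebra Literature.NumberTheory.EllipticCurves.Rank1Residual
  Summit.BirchSwinnertonDyer.Rank1Residual Summit.BirchSwinnertonDyer.Rank1Residual.X11b
  Summit.BirchSwinnertonDyer.Rank1Residual.X11b.Coinv Summit.BirchSwinnertonDyer.Rank1Residual.X11b.AcSelmer
  Summit.BirchSwinnertonDyer.Rank1Residual.X11b.LocBridge Summit.BirchSwinnertonDyer.Rank1Residual.Iwasawa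
  Summit.BirchSwinnertonDyer.BirchSwinnertonDyer.Theorems.UniversalToricDescentSigmaPassage
  Summit.BirchSwinnertonDyer.BirchSwinnertonDyer.Theorems.UniversalToricDescentNoFiniteSubmodule
  Summit.BirchSwinnertonDyer.BirchSwinnertonDyer.Theorems.UniversalToricDescentSigmaLocalImage
  Summit.BirchSwinnertonDyer.BirchSwinnertonDyer.Theorems.UniversalToricDescentTorsionMuTransportHeegner

/-- **`n + Σ_{v∈Σ} 3^{c_v}·s_v(E) = λ_alg(E′) + Σ_{v∈Σ} 3^{c_v}·s_v(E′)`** — the algebraic half of ♭T in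
the additive λ-currency, direction `E → E′`: from `X_{∅,0}(E)` torsion with a generator of profile `n`
(+ (iv), Poitou–Tate ×2, base finiteness at `v ∣ 3` for `E` and `E′`) there are the finite bad set `Σ`,
exact indices `c_v` and local exponents `#H¹(kerD κ v, E[3^∞])[3] = 3^{s_v}`, `#H¹(kerD κ v, E′[3^∞])[3] = 3^{s′_v}`
such that `X_{∅,0}(E′)` is torsion with a generator of norm profile `λ_alg(E′)` and the displayed identity
holds. The Σ-terms are Greenberg–Vatsal's `d_v` (`…LocalTermClosedForm`); the analytic half must match them.
[cite: GreenbergVatsal2000, Thm. (1.4), §2 Prop. (2.4) and (2.10) (pp. 23–28)] [cite: Brink2007, Thm. 2 and Cor. 1] -/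
theorem defectTransport_algebraicHalf_lambda (W W' : WeierstrassCurve ℚ) [W.IsElliptic]
    [W.IsGloballyMinimal] [W'.IsElliptic] [W'.IsGloballyMinimal] {N N' : ℕ} (K : Type) [Field K]
    [NumberField K]
    (hO6 : Additive.ClassO6 W 3) (hN : W.conductorNorm ℤ = N) (hcong : O6.ModPCongruent W' W 3)
    (hN' : W'.conductorNorm ℤ = N') (hK : IsImaginaryQuadratic K)
    (hHe : SatisfiesHeegnerHypothesis N K) (hHe' : SatisfiesHeegnerHypothesis N' K)
    (κ : ZpExtension K 3) (hκ : κ.IsAnticyclotomic) (γ : absoluteGaloisGroup K)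
    [Fact (κ.IsTopGenerator γ)] {𝔭' : HeightOneSpectrum (𝓞 K)} (h𝔭' : ((3 : ℕ) : 𝓞 K) ∈ 𝔭'.asIdeal)
    (hT : Module.IsTorsion (IwasawaAlgebra 3) (XAc (W.baseChange K) 3 κ 𝔭' ∅ γ))
    {g : UnrSeries 3} {n : ℕ}
    (hg : (XAc.charIdeal (W.baseChange K) 3 κ 𝔭' ∅ γ).map (PowerSeries.map (Halves.toUnr 3)) =
      Ideal.span {g})
    (hn : (∀ i < n, ‖((PowerSeries.coeff i g : unrIntegers 3) : ℂ_[3])‖ < 1) ∧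
      ‖((PowerSeries.coeff n g : unrIntegers 3) : ℂ_[3])‖ = 1)
    (h4 : ∀ R : (W.baseChange ℚ_[3]).toAffine.Point, 3 • R = 0 → R = 0)
    (hPT : poitouTate_selmerStructure_duality K) (hPT2 : poitouTate_sha_tateDual K)
    (hfin : ∀ v : HeightOneSpectrum (𝓞 K), ((3 : ℕ) : 𝓞 K) ∈ v.asIdeal →
      Finite (selmerAcBase (W.baseChange K) 3 v ∅))
    (hfin' : ∀ v : HeightOneSpectrum (𝓞 K), ((3 : ℕ) : 𝓞 K) ∈ v.asIdeal →
      Finite (selmerAcBase (W'.baseChange K) 3 v ∅)) :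
    ∃ (T : Finset (HeightOneSpectrum (𝓞 K))) (c s s' : HeightOneSpectrum (𝓞 K) → ℕ),
      (↑T = {v : HeightOneSpectrum (𝓞 K) | ((3 : ℕ) : 𝓞 K) ∉ v.asIdeal ∧
        (¬ (W.baseChange K).HasGoodReductionAt v ∨ ¬ (W'.baseChange K).HasGoodReductionAt v)}) ∧
      (∀ v ∈ T, (∃ d₀ : decomp (K := K) v, (κ (d₀ : absoluteGaloisGroup K)).toAdd = (3 : ℤ_[3]) ^ c v) ∧
        (∀ d : decomp (K := K) v, (3 : ℤ_[3]) ^ c v ∣ (κ (d : absoluteGaloisGroup K)).toAdd) ∧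
        Nat.card {f : subgroupH1 (kerD κ v) ((W.baseChange K).geomPrimaryTorsion 3) // 3 • f = 0} =
          3 ^ s v ∧
        Nat.card {f : subgroupH1 (kerD κ v) ((W'.baseChange K).geomPrimaryTorsion 3) // 3 • f = 0} =
          3 ^ s' v) ∧
      Module.IsTorsion (IwasawaAlgebra 3) (XAc (W'.baseChange K) 3 κ 𝔭' ∅ γ) ∧
      (∃ g' : UnrSeries 3,
        (XAc.charIdeal (W'.baseChange K) 3 κ 𝔭' ∅ γ).map (PowerSeries.map (Halves.toUnr 3)) =
            Ideal.span {g'} ∧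
          (∀ i < lambdaInvariant 3 (XAc (W'.baseChange K) 3 κ 𝔭' ∅ γ),
            ‖((PowerSeries.coeff i g' : unrIntegers 3) : ℂ_[3])‖ < 1) ∧
          ‖((PowerSeries.coeff (lambdaInvariant 3 (XAc (W'.baseChange K) 3 κ 𝔭' ∅ γ)) g' :
            unrIntegers 3) : ℂ_[3])‖ = 1) ∧
      n + ∑ v ∈ T, 3 ^ c v * s v =
        lambdaInvariant 3 (XAc (W'.baseChange K) 3 κ 𝔭' ∅ γ) + ∑ v ∈ T, 3 ^ c v * s' v := by
  haveI : Fact (Nat.Prime 3) := ⟨Nat.prime_three⟩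
  obtain ⟨T, c, hTS, hcT, hTor', g', hg', hglt', hgeq', hcount⟩ :=
    defectTransport_algebraicHalf_local W W' K hO6 hN hcong hN' hK hHe hHe' κ hκ γ h𝔭' hT hg hn h4 hPT
      hPT2 hfin hfin'
  -- the places of `T` are prime to `3` and finitely decomposed
  have hTp : ∀ v ∈ T, ((3 : ℕ) : 𝓞 K) ∉ v.asIdeal := fun v hv ↦ by
    have h : v ∈ (↑T : Set (HeightOneSpectrum (𝓞 K))) := Finset.mem_coe.mpr hv
    rw [hTS] at h
    exact h.1
  have hTdec : ∀ v ∈ T, ¬ (decomp v ≤ κ.kerSubgroup) := by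
    intro v hv hle
    obtain ⟨⟨d₀, hd₀⟩, -⟩ := hcT v hv
    have h1 : κ (d₀ : absoluteGaloisGroup K) = 1 := (ZpExtension.mem_kerSubgroup).mp (hle d₀.2)
    rw [h1, toAdd_one] at hd₀
    exact pow_ne_zero (c v) (by norm_num : (3 : ℤ_[3]) ≠ 0) hd₀.symm
  -- the local exponents
  choose! s hs using fun v (hv : v ∈ T) ↦
    exists_natCard_pTorsion_subgroupH1_kerD_eq_pow (W.baseChange K) κ (by exact_mod_cast hTp v hv)
      (hTdec v hv)
  choose! s' hs' using fun v (hv : v ∈ T) ↦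
    exists_natCard_pTorsion_subgroupH1_kerD_eq_pow (W'.baseChange K) κ (by exact_mod_cast hTp v hv)
      (hTdec v hv)
  refine ⟨T, c, s, s', hTS, fun v hv ↦ ⟨(hcT v hv).1, (hcT v hv).2, hs v hv, hs' v hv⟩, hTor',
    ⟨g', hg', hglt', hgeq'⟩, ?_⟩
  -- exponents from the `Nat.card` identity
  have e1 : ∏ v ∈ T, Nat.card {f : subgroupH1 (kerD κ v) ((W.baseChange K).geomPrimaryTorsion 3) //
      3 • f = 0} ^ (3 ^ c v) = 3 ^ ∑ v ∈ T, 3 ^ c v * s v := by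
    rw [← Finset.prod_pow_eq_pow_sum]
    exact Finset.prod_congr rfl fun v hv ↦ by rw [hs v hv, ← pow_mul, Nat.mul_comm (s v)]
  have e2 : ∏ v ∈ T, Nat.card {f : subgroupH1 (kerD κ v) ((W'.baseChange K).geomPrimaryTorsion 3) //
      3 • f = 0} ^ (3 ^ c v) = 3 ^ ∑ v ∈ T, 3 ^ c v * s' v := by
    rw [← Finset.prod_pow_eq_pow_sum]
    exact Finset.prod_congr rfl fun v hv ↦ by rw [hs' v hv, ← pow_mul, Nat.mul_comm (s' v)]
  rw [e1, e2, ← pow_add, ← pow_add] at hcount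
  exact Nat.pow_right_injective (by norm_num : 2 ≤ 3) hcount

/-- **The same with the wild curve's base finiteness DISCHARGED from rank-one data** (`rank E(K) = 1`,
`Ш(E/K)` finite, a point of infinite order — on the route: Gross–Zagier–Kolyvagin at `r_an(E) = 1`); the
twin's base finiteness `hfin′` remains an input. [cite: GreenbergVatsal2000, Thm. (1.4), §2 Prop. (2.4) and (2.10)]
[cite: JetchevSkinnerWan2017, Prop. 3.2.1 (arXiv:1512.06894 pp. 10–11)] -/
theorem defectTransport_algebraicHalf_lambda_of_rankOne (W W' : WeierstrassCurve ℚ) [W.IsElliptic]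
    [W.IsGloballyMinimal] [W'.IsElliptic] [W'.IsGloballyMinimal] {N N' : ℕ} (K : Type) [Field K]
    [NumberField K]
    (hO6 : Additive.ClassO6 W 3) (hN : W.conductorNorm ℤ = N) (hcong : O6.ModPCongruent W' W 3)
    (hN' : W'.conductorNorm ℤ = N') (hK : IsImaginaryQuadratic K)
    (hHe : SatisfiesHeegnerHypothesis N K) (hHe' : SatisfiesHeegnerHypothesis N' K)
    (κ : ZpExtension K 3) (hκ : κ.IsAnticyclotomic) (γ : absoluteGaloisGroup K)
    [Fact (κ.IsTopGenerator γ)] {𝔭' : HeightOneSpectrum (𝓞 K)} (h𝔭' : ((3 : ℕ) : 𝓞 K) ∈ 𝔭'.asIdeal)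
    (hT : Module.IsTorsion (IwasawaAlgebra 3) (XAc (W.baseChange K) 3 κ 𝔭' ∅ γ))
    {g : UnrSeries 3} {n : ℕ}
    (hg : (XAc.charIdeal (W.baseChange K) 3 κ 𝔭' ∅ γ).map (PowerSeries.map (Halves.toUnr 3)) =
      Ideal.span {g})
    (hn : (∀ i < n, ‖((PowerSeries.coeff i g : unrIntegers 3) : ℂ_[3])‖ < 1) ∧
      ‖((PowerSeries.coeff n g : unrIntegers 3) : ℂ_[3])‖ = 1)
    (h4 : ∀ R : (W.baseChange ℚ_[3]).toAffine.Point, 3 • R = 0 → R = 0)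
    (hPT : poitouTate_selmerStructure_duality K) (hPT2 : poitouTate_sha_tateDual K)
    (hrank : (W.baseChange K).mordellWeilRank = 1) (hSha : (W.baseChange K).ShaFinite)
    (P : (W.baseChange K).toAffine.Point) (hP : ¬ IsOfFinAddOrder P)
    (hfin' : ∀ v : HeightOneSpectrum (𝓞 K), ((3 : ℕ) : 𝓞 K) ∈ v.asIdeal →
      Finite (selmerAcBase (W'.baseChange K) 3 v ∅)) :
    ∃ (T : Finset (HeightOneSpectrum (𝓞 K))) (c s s' : HeightOneSpectrum (𝓞 K) → ℕ),
      (↑T = {v : HeightOneSpectrum (𝓞 K) | ((3 : ℕ) : 𝓞 K) ∉ v.asIdeal ∧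
        (¬ (W.baseChange K).HasGoodReductionAt v ∨ ¬ (W'.baseChange K).HasGoodReductionAt v)}) ∧
      (∀ v ∈ T, (∃ d₀ : decomp (K := K) v, (κ (d₀ : absoluteGaloisGroup K)).toAdd = (3 : ℤ_[3]) ^ c v) ∧
        (∀ d : decomp (K := K) v, (3 : ℤ_[3]) ^ c v ∣ (κ (d : absoluteGaloisGroup K)).toAdd) ∧
        Nat.card {f : subgroupH1 (kerD κ v) ((W.baseChange K).geomPrimaryTorsion 3) // 3 • f = 0} =
          3 ^ s v ∧
        Nat.card {f : subgroupH1 (kerD κ v) ((W'.baseChange K).geomPrimaryTorsion 3) // 3 • f = 0} =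
          3 ^ s' v) ∧
      Module.IsTorsion (IwasawaAlgebra 3) (XAc (W'.baseChange K) 3 κ 𝔭' ∅ γ) ∧
      (∃ g' : UnrSeries 3,
        (XAc.charIdeal (W'.baseChange K) 3 κ 𝔭' ∅ γ).map (PowerSeries.map (Halves.toUnr 3)) =
            Ideal.span {g'} ∧
          (∀ i < lambdaInvariant 3 (XAc (W'.baseChange K) 3 κ 𝔭' ∅ γ),
            ‖((PowerSeries.coeff i g' : unrIntegers 3) : ℂ_[3])‖ < 1) ∧
          ‖((PowerSeries.coeff (lambdaInvariant 3 (XAc (W'.baseChange K) 3 κ 𝔭' ∅ γ)) g' :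
            unrIntegers 3) : ℂ_[3])‖ = 1) ∧
      n + ∑ v ∈ T, 3 ^ c v * s v =
        lambdaInvariant 3 (XAc (W'.baseChange K) 3 κ 𝔭' ∅ γ) + ∑ v ∈ T, 3 ^ c v * s' v := by
  haveI : Fact (Nat.Prime 3) := ⟨Nat.prime_three⟩
  have hadd : Addv W 3 := hO6.2.1
  have hpN : 3 ∣ W.conductorNorm ℤ :=
    (W.dvd_conductorNorm_iff_not_hasGoodReductionAtPrime 3).mpr hadd.1
  have hsplit : SplitsIn K 3 := hHe 3 (Fact.out) (hN ▸ hpN)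
  exact defectTransport_algebraicHalf_lambda W W' K hO6 hN hcong hN' hK hHe hHe' κ hκ γ h𝔭' hT hg hn h4
    hPT hPT2 (finite_selmerAcBase_of_rankOne W 3 h4 hK hsplit hPT hrank hSha P hP) hfin'

end Summit.BirchSwinnertonDyer.BirchSwinnertonDyer.Theorems.UniversalToricDescentDefectTransport

end
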